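import Mathlib
import Summits.ResolutionOfSingularities.ResolutionOfSingularities.Theorems.RadicialJungCleanModelsCleanPatchingDefs
import Literature.AlgebraicGeometry.Resolution.ProjectiveModels
import HarnessLib

/-!
# Route `RadicialJung`, crux `CleanModels` (stmt-ResolutionOfSingularities-15917), line `Sketch` rev 14, stub 4c
# `stub_cleanGlobalization3`: patching a finite clean resolving system (open form)

The `P_clean` twin, in OPEN form, of `ProjModel.exists_dominating_regCentre` (`ZariskiPatchingGlue.lean`; Zariski 1944,
Fundamental Theorem p. 539; Piltant 2013, Cor. 5.7: «by applying `n − 1` consecutive times proposition 5.1»): if any two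
projective models of `K/k` with opens of clean-regular points are dominated by one which is clean-regular over both opens
(the registered stub `stub_cleanTwoModelPatching3`, taken as the hypothesis `hZ`), then for every projective model `M₀`
and every finite list of models with clean opens there is `N → M₀` with an open of clean-regular points containing the
centre of every valuation whose centre on some listed model lies in its open (`exists_dominating_cleanOn`).  PROVED;
bookkeeping only; nothing here proves resolution in characteristic `p`.
-/

noncomputable section

set_option linter.dupNamespace false -- mandated namespace of this single-conjunct summit

open CategoryTheory AlgebraicGeometry
open Literature.AlgebraicGeometry.Resolution

namespace Summit.ResolutionOfSingularities.ResolutionOfSingularities.Theorems.RadicialJung.CleanModels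

variable {k K : Type} [Field k] [Field K] [Algebra k K] {p : ℕ} {g₀ : K}

/-- **Patching a finite clean resolving system, open form** (the `P_clean` twin of
`ProjModel.exists_dominating_regCentre`): under the open-form two-model patching hypothesis for `P_clean(g₀)`, every
projective model `M₀` and every finite list of (model, open of clean-regular points) is dominated by some `N → M₀` carrying an
open `V` of clean-regular points which contains the centre of every valuation centred in one of the listed opens.
[cite: Piltant2013, Cor. 5.7] -/
theorem exists_dominating_cleanOn
    (hZ : ∀ (M₁ M₂ : ProjModel k K) (U₁ : M₁.X.Opens) (U₂ : M₂.X.Opens),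
      (∀ x ∈ U₁, ModelCleanRegAt p g₀ M₁ x) → (∀ x ∈ U₂, ModelCleanRegAt p g₀ M₂ x) →
      ∃ (N : ProjModel k K) (φ₁ : N.Hom M₁) (φ₂ : N.Hom M₂),
        (∀ y : N.X, φ₁.f y ∈ U₁ → ModelCleanRegAt p g₀ N y) ∧ (∀ y : N.X, φ₂.f y ∈ U₂ → ModelCleanRegAt p g₀ N y))
    (M₀ : ProjModel k K) :
    ∀ l : List (Σ M : ProjModel k K, M.X.Opens), (∀ MU ∈ l, ∀ x ∈ MU.2, ModelCleanRegAt p g₀ MU.1 x) →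
      ∃ (N : ProjModel k K) (_ : N.Hom M₀) (V : N.X.Opens), (∀ y ∈ V, ModelCleanRegAt p g₀ N y) ∧
        ∀ v : ZariskiRiemannSpace k K, (∃ MU ∈ l, MU.1.centre v ∈ MU.2) → N.centre v ∈ V
  | [], _ => ⟨M₀, ⟨𝟙 M₀.X, Category.id_comp _, Category.comp_id _⟩, ⊥,
      fun y hy => absurd hy (by simp), fun v ⟨_, hMU, _⟩ => by simp at hMU⟩
  | MU :: l, hl => by
    obtain ⟨N, ψ, V, hV, hcen⟩ := exists_dominating_cleanOn hZ M₀ l fun MU' hMU' => hl MU' (List.mem_cons_of_mem _ hMU')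
    obtain ⟨N', φ₁, φ₂, h₁, h₂⟩ := hZ N MU.1 V MU.2 hV (hl MU List.mem_cons_self)
    refine ⟨N', φ₁.comp ψ, φ₁.f ⁻¹ᵁ V ⊔ φ₂.f ⁻¹ᵁ MU.2, fun y hy => ?_, fun v hv => ?_⟩
    · rcases hy with hy | hy
      · exact h₁ y hy
      · exact h₂ y hy
    · obtain ⟨MU', hMU', hc⟩ := hv
      rcases List.mem_cons.mp hMU' with rfl | hl'
      · right
        change φ₂.f (N'.centre v) ∈ MU'.2
        rw [φ₂.map_centre v]
        exact hc
      · left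
        change φ₁.f (N'.centre v) ∈ V
        rw [φ₁.map_centre v]
        exact hcen v ⟨MU', hl', hc⟩

end Summit.ResolutionOfSingularities.ResolutionOfSingularities.Theorems.RadicialJung.CleanModels

end
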